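import Literature.NumberTheory.Automorphic.Liu2021.LemD1Item4AsPrintedIndexed
import Literature.NumberTheory.Automorphic.Liu2021.CheckOfChiLocalMuTwist
import Literature.NumberTheory.GelbartRogawski1991.UndoublingPlaceAssembly
import Literature.NumberTheory.GelbartRogawski1991.DoubledWeilRepresentationCMExplicit
import Literature.NumberTheory.Automorphic.Liu2021.LemD1Item1AtV2OfSplitCM
import HarnessLib

/-!
# [Liu2021, App. D, Lemma D.1 (1) and (4)] AS PRINTED, read on the RANK-2 CM θ-packages of the tree: the two LETTERS of the
# P5 pay-down line (`stub_letter_lemD14_nonsplit`, `stub_letter_lemD11`) as NAMED FACTS — row R2′-L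

[Liu2021] = Y. Liu, *Fourier–Jacobi cycles and arithmetic relative trace formula (with an appendix by C. Li and Y. Zhu)*, Camb. J.
Math. **9** (2021), no. 1, 1–147 = arXiv:2102.11518; Lemma D.1 is printed on pp. 125–126 (item (1) p. 125, item (4) p. 126 lines 1–3,
proof p. 126); `l. NNNN` = lines of the author's TeX source `FJcycle.tex` (md5 `6db49a74122d…`; Lemma D.1 = `le:weil_nonarch`, l. 5226–5238;
shelf card `run/shared/lean/pub/hodgecm-mathlib/shelf/Liu2021-Def411-Prop413-Thm418-LemD1.md` ITEM 4∕5; held extraction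
`paper:arxiv-2102.11518` p0056 L21–L29, read 2026-08-31).

Topic `NumberTheory/Automorphic/Liu2021`; namespace `Literature.NumberTheory.Automorphic.Liu2021.LemD1RankTwoCMLetters` (a sub-namespace of the home of ★ `LemD1_1AsPrinted`
(`LemD1AsPrinted.lean` §2), ★ `LemD1_4AsPrintedI`, ★ `Def411WeilCarriers.localLemD1DataAtV₂`, ★ `Def411WeilCarriers.localIndexedFamilyAtV₂`
(`LemD1Item4AsPrintedIndexed.lean`), which this file REUSES; nothing is re-declared; the sub-namespace keeps the four plumbing names off the crowded `Liu2021` ∕ `Def411WeilCarriers` roots — decl names as fixed by the row owner F0P5-plan (g4) 2026-08-31T17:58:29Z (2)).  CONTENT: exactly TWO cite-tagged NAMED FACTS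
`def … : Prop` with bodies (`LemD1_4AsPrintedNonsplitCM₂`, `LemD1_1AsPrintedCM₂`) + their two `Iff.rfl` unfoldings, NOTHING ELSE at ED. 1 (row owner's
rule «β», cell bus 2026-08-31T18:16:03Z; ED. 2 below APPENDS the third letter `LemD1_1AsPrintedNonsplitCM₂` = the `h1` CUT + proved bookkeeping
`toNonsplit` ∕ `toAllPlaces` ∕ `lemD1_1AsPrintedCM₂_iff_nonsplit` and ONE import ★ `Liu2021.LemD1Item1AtV2OfSplitCM`; ED. 3 APPENDS the generic «if»-reading
`Liu2021.LemD1_4IfAsPrintedI` of (4) + the fifth letter `LemD1_4IfAsPrintedNonsplitCM₂` («L4-if») + the proved projections `toIf`): the four plumbing proofs that the assembler passes as NAMED arguments inside these types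
(`two_le_of_finTwo_equiv e₁`, `norm_localMu_pair L lam lam'`, `continuous_localMu_pair L lam lam'`, `localMu_pair_toLocalRing_eq_one_iff L lam hlam lam' hlam'` —
public in ★ `Summits/HodgeConjecture/HodgeConjecture/Theorems/F0P5CurveThetaCompanionRelabelOfLocalFactors.lean` §0–§1, which a Literature file cannot import and
must not duplicate) are INLINED here as `(by …)` terms with the same tactic scripts, so each body = the assembler's binder type TOKEN FOR TOKEN
OUTSIDE those four proof arguments, and definitionally equal to it (proof irrelevance) — the ED. 5 fold needs no more; no `instance`, no `notation`, no `attribute`, no `sorry`, no `axiom`.  Cell `hodgecm-mathlib`, floor 0, programme P5, typer row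
R2′-L (F0P5-plan (g4), cell bus 2026-08-31T17:51:54Z (3); rule «β» 18:16:03Z): the two binder types `h4` ∕ `h1` of the R2′ ASSEMBLER head
★ `Summit.HodgeConjecture.HodgeConjecture.Cruxes.HLiu418.F0P5CurveThetaCompanionRelabelOfLocalFactors.companionRelabelTransfer₂_of_nonsplit_lemD1_4`
(A-p17 (g18), p830748 ACCEPTED 2026-08-31T18:17Z; tree file `Summits/HodgeConjecture/HodgeConjecture/Theorems/F0P5CurveThetaCompanionRelabelOfLocalFactors.lean`
sha16 `fab1855920daf5a4` :261–:272 and :273–:285; REF «=» ref2 (g18) l12 2026-08-31T17:55:13Z on the same text) TOKEN FOR TOKEN as the bodies —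
outside the four proof arguments, which are inlined (see CONTENT) — so that the pay-down line
`Summits/HodgeConjecture/HodgeConjecture/Cruxes/HLiu418/Lines/F0_P5_CurveThetaLettersPaydown.lean` ED. 5 registers the two letters BY NAME
(`theorem stub_letter_lemD14_nonsplit : LemD1RankTwoCMLetters.LemD1_4AsPrintedNonsplitCM₂`, `theorem stub_letter_lemD11 : LemD1RankTwoCMLetters.LemD1_1AsPrintedCM₂`) and the
books count them by declaration name.

THE PRINT (TeX l. 5213, 5226–5235; print pp. 125–126), VERBATIM.  Set-up (l. 5213): «Let `F` be a local field whose characteristic is not `2`.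
Let `E` be an étale `F`-algebra of rank `2`. … Let `V, ( , )_V` be a (non-degenerate) hermitian space over `E` (with respect to `c`) of rank
`n ≥ 2`.»; Steps 1–3 (l. 5217–5221) construct `ω(ε)`, `ω(μ, ε) ≔ ω(ε) ∘ ι_μ`, and `ω(μ, ε, χ)` = the maximal quotient of `ω(ε, μ)` of `U(V)` with
central character `χ`; l. 5224: «we define a character `χ̌` of `E^×` via the formula `χ̌(x) = χ(x/x^c)`.»  Lemma D.1 (l. 5226–5238): «Suppose that
`F` is nonarchimedean. Then `ω(μ, ε, χ)` is irreducible and admissible. Moreover, (1) `ω(μ, ε, χ)` is zero if and only if `E` is a field, `V` is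
anisotropic (in particular `n = 2`), and `χ̌ = μ²`. … (4) If `n = 2` and `ω(μ, ε, χ)` is nonzero, then `ω(μ′, ε′, χ′)` is isomorphic to
`ω(μ, ε, χ)` if and only if either `(μ′, ε′, χ′) = (μ, ε, χ)`, or `μ′ = μ^c χ̌`, `χ′ = χ`, and `ε′ = ε` (resp. `ε′ ≠ ε`) when `V` is isotropic
(resp. anisotropic).»  (Printed proof, p. 126 = l. 5240–5262: split `E = F × F` by [GR90, 2.6]; irreducibility by Howe duality [GT16, Thm. 1.1 (1)];
(1) by [HKS96, Prop. 5.1 (iii)] + [SZ15, Thm. 1.10]; (4) by [GGP2, §8, Thm. 10.2].)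

THE LEAN TEXT.  The tree types the printed sentences as PREDICATES on the consumer's own Step 1–3 data — ★ `LemD1_1AsPrinted (Ld : LemD1Data F E n)`
(first sentence + item (1), `LemD1AsPrinted.lean` :261) and ★ `LemD1_4AsPrintedI (Lf : LemD1IndexedFamily F E n ι)` (item (4) for every pair of
members of an INDEXED collection, READING I3 of ★ `LemD1AsPrintedIndexed.lean`: the restriction of the printed universal statement along the index
map — WEAKER OR EQUAL to print) — and ★ `LemD1Item4AsPrintedIndexed.lean` §4 instantiates the data at a finite place `v` of the totally real
field `L⁺ = Fp L` of a CM field `L` for the rank-`n ≥ 2` θ-packages of the tree (`localLemD1DataAtV₂`, `localIndexedFamilyAtV₂`: `F = L⁺_v`,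
`E = L ⊗ L⁺_v = LocalRing L v`, `V = (L_v^n, diag)`, Step 1 `ε = ε_a` the line `⟨a⟩`, Step 2 `μ_v` the caller's character of `L_vˣ`, Step 3 `χ_v`
the local component of the global `χ : Chi`, carrier `ω(μ_v, ε_v)` = the local Weil factor `(𝓢).omegaLoc v` of the global splitting package `𝓢`).
This file fixes `n = 2`, the frame `V = diag dV` (`dV : Fin 2 → L` real, non-zero), the CM θ-packages `𝓢 = congrW … (undoubledSplittings … (toHeckeCharacter L λ)
(borelPlaceMeasure L) (cmFinLocalFamily …))` attached to CONJUGATE-SYMPLECTIC idèle class characters `λ` (★ `IsConjugateSymplectic`; the Step-2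
slot `μ_v := localMu L (toHeckeCharacter L λ) v`, ★ `CMSplittingCharLocalMu.lean`, whose three printed properties `|μ_v| = 1`, continuity,
`ker (μ_v|_{L⁺_vˣ}) = Nm` are the inlined plumbing proofs, ★ `norm_localMu` ∕ `continuous_localMu` ∕ `localMu_toLocalRing_eq_one_iff`), and states:
* `LemD1_4AsPrintedNonsplitCM₂` — item (4) AS PRINTED (READING I3) on the TWO-member indexed family `0 ↦ (λ, a, χ)`, `1 ↦ (λ′, a′, χ)` at every
  finite place `v` of `L⁺` that is NOT SPLIT in `L` (`∀ w ∣ v, c • w = w`, so `E = L_v` is a field), for every CM field `L`, frame `dV`, lines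
  `a, a′ ∈ L⁺ˣ`, central character `χ`, and conjugate-symplectic `λ, λ′` under the companion equation `λ′ = λᶜ · χ̌` (as Hecke characters,
  ★ `IdeleClassGroup.galConj`, ★ `HeckeCharacter.checkOfChi`);
* `LemD1_1AsPrintedCM₂` — the first sentence + item (1) AS PRINTED on the θ-package datum of ONE member `(λ′, a′, χ)` at EVERY finite place `v`
  of `L⁺`, for every CM field `L`, frame `dV`, line `a′`, `χ`, conjugate-symplectic `λ′`.
Both are specialisations (fewer triples, fewer places, CM packages only) of the printed lemma read on the tree's model of `ω(μ, ε, χ)`; neither is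
stronger than print.  CONSUMER ROAD (F0-typ3 (g9), author of ★ `LemD1Item4AsPrintedIndexed`, cell bus 2026-08-31T18:10:36Z): in
`LemD1_4AsPrintedNonsplitCM₂` member `0` = the base package `(λ, a, χ)`, member `1` = the companion `(λ′, a′, χ)`; a consumer applies
`h : LemD1_4AsPrintedNonsplitCM₂` to its data and reads the local factors through ★ `lemD1_4_localFactors_of_lemD1_4AsPrintedI₂ … (h …) rfl 0 1 hi`
∕ ★ `LemD1_4AsPrintedI.areIsomorphicRep_of_muTwist`; the `IsModuleTopology` instance the `muTwist` clause needs is the THEOREM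
★ `LemD1OfPlace.isModuleTopology_localRing L v` (use `letI`/`haveI`, there is no global instance) — exactly as in the R2′ assembler's §2.  HONEST LABEL: two NAMED FACTS, asserted and NOT proved here or anywhere in the tree (searched 2026-08-31: the ★ files
`LemD1AsPrinted*`, `LemD1Item4AsPrintedIndexed`, `Def411WeilCarriersLocalDataAtV` declare predicates and read-backs only — «NOTHING of [Liu2021] is
asserted» — and the in-house payments ★ `LemD1Item1AtV2OfSplit` ∕ B-p08 (g22)'s split node treat the SPLIT places only); the pay-down line's
`stub_letter_*` theorems are `sorry` against exactly these two names until a prover or the print closes them.  HC_CM is proved only modulo the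
printed citations until rung 0 closes.

## References
* Y. Liu, *Fourier–Jacobi cycles and arithmetic relative trace formula*, Camb. J. Math. **9** (2021) 1–147, App. D §D.1, Lemma D.1 (1), (4),
  pp. 125–126 (TeX l. 5226–5238; proof l. 5240–5262) [Liu2021].
* M. Harris, S. Kudla, W. J. Sweet, *Theta dichotomy for unitary groups*, J. AMS **9** (1996), §1, Prop. 5.1 (iii) [HarrisKudlaSweet1996] (the
  printed inputs of Step 2 and of item (1)).
-/

set_option autoImplicit false


open scoped Matrix Kronecker RestrictedProduct NumberField TensorProduct
open NumberField NumberField.mixedEmbedding IsDedekindDomain Filter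
open Literature.NumberTheory Literature.NumberTheory.Automorphic Literature.NumberTheory.Automorphic.UnitaryGroup
open Literature.NumberTheory.GelbartRogawski1991 Literature.NumberTheory.GelbartRogawski1991.UnitaryDualPair
open Literature.NumberTheory.GelbartRogawski1991.UnitaryDualPair.WeilCoinv
open Literature.NumberTheory.GelbartRogawski1991.UnitaryDualPair.LocalSplitting
open Literature.NumberTheory.GelbartRogawski1991.GRConstruction
open Literature.NumberTheory.Weil1964 Literature.RepresentationTheory
open Literature.RepresentationTheory.HeisenbergGroup
open Literature.NumberTheory.GaloisRepresentations Literature.RepresentationTheory.HarrisKudlaSweet1996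
open Literature.NumberTheory.Automorphic.IdeleClassGroup Literature.RepresentationTheory.Liu2021
open Literature.NumberTheory.Automorphic.Liu2021 Literature.NumberTheory.Automorphic.Liu2021.Def411WeilCarriers
open Literature.NumberTheory.Automorphic.Liu2021.Def411WeilCarriersDoubling

namespace Literature.NumberTheory.Automorphic.Liu2021.LemD1RankTwoCMLetters

/-! ## The two letters AS PRINTED, as named facts (the four plumbing proofs INLINED at their argument sites) -/

/-- **[Liu2021, App. D, Lemma D.1 (4)] AS PRINTED (READING I3) ON THE TWO MEMBERS `(λ, a, χ)`, `(λ′, a′, χ)` OF THE RANK-2 CM θ-PACKAGE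
FAMILY AT THE NON-SPLIT FINITE PLACES** — Y. Liu, Camb. J. Math. 9 (2021), Lemma D.1 (4), p. 126 (TeX l. 5235): «If `n = 2` and `ω(μ, ε, χ)` is
nonzero, then `ω(μ′, ε′, χ′)` is isomorphic to `ω(μ, ε, χ)` if and only if either `(μ′, ε′, χ′) = (μ, ε, χ)`, or `μ′ = μ^c χ̌`, `χ′ = χ`, and
`ε′ = ε` (resp. `ε′ ≠ ε`) when `V` is isotropic (resp. anisotropic).» — typed as ★ `LemD1_4AsPrintedI` of the indexed family
★ `localIndexedFamilyAtV₂ … ![a, a′] (fun _ => χ) ⟨𝓢_λ,a, 𝓢_λ′,a′⟩ ![μ(λ), μ(λ′)] … v` for: every CM field `L`, real non-zero frame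
`dV : Fin 2 → L`, `e₁ : Fin 2 × Fin 1 ≃ Fin n'`, conjugate-symplectic idèle class characters `λ, λ′` of `L` with `λ′ = λᶜ · χ̌` as Hecke
characters, lines `a, a′ ∈ L⁺ˣ`, central character `χ`, and every finite place `v` of `L⁺` with `c • w = w` for all `w ∣ v` (non-split: `E = L_v`
a field).  The binder type `h4` of the R2′ assembler head ★ `companionRelabelTransfer₂_of_nonsplit_lemD1_4`, token for token outside the four inlined proof arguments.  A NAMED FACT (not proved here).
[cite: Liu2021, App. D Lem. D.1 (4) (p. 126, TeX l. 5235); §D.1 Steps 1–3 (l. 5217–5221)] -/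
def LemD1_4AsPrintedNonsplitCM₂ : Prop :=
  ∀ (L : Type) [Field L] [NumberField L] [IsCMField L]
      (dV : Fin 2 → L) (hdV : ∀ i, IsCMField.complexConj L (dV i) = dV i) (hdV0 : ∀ i, dV i ≠ 0)
      {n' : ℕ} (e₁ : Fin 2 × Fin 1 ≃ Fin n')
      (lam : Literature.NumberTheory.Automorphic.IdeleClassGroup L →ₜ* Circle) (hlam : IsConjugateSymplectic L lam)
      (a : (↥(maximalRealSubfield L))ˣ) (χ : Chi (↥(maximalRealSubfield L)) L (IsCMField.complexConj L)) (a' : (↥(maximalRealSubfield L))ˣ)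
      (lam' : Literature.NumberTheory.Automorphic.IdeleClassGroup L →ₜ* Circle) (hlam' : IsConjugateSymplectic L lam')
      (hcc : IsCMField.complexConj L * IsCMField.complexConj L = 1),
      toHeckeCharacter L lam' =
        toHeckeCharacter L (IdeleClassGroup.galConj (IsCMField.complexConj L) lam) * HeckeCharacter.checkOfChi hcc χ →
    ∀ (v : HeightOneSpectrum (𝓞 ↥(maximalRealSubfield L))),
      (∀ w : UnitaryGroup.PlacesOver L v, IsCMField.complexConj L • (w : HeightOneSpectrum (𝓞 L)) = w) →
      LemD1_4AsPrintedI (localIndexedFamilyAtV₂ (Fp L) L (IsCMField.complexConj L) 2 e₁ (Matrix.diagonal dV) (complexConj_imagUnit L) (imagUnit_ne_zero L) (imagUnit_mul_self L) (realDiagonal_isSymm L dV hdV) (isUnit_det_realDiagonal L dV hdV hdV0) (realDiagonal_map L dV hdV).symm (by -- `2 ≤ n'` (§D.1 «rank n ≥ 2»); the assembler's proof argument here is `two_le_of_finTwo_equiv e₁`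
          have h := Fintype.card_congr e₁
          simp only [Fintype.card_prod, Fintype.card_fin, mul_one] at h
          omega) ![a, a'] (fun _ => χ) (Fin.cons (α := fun i : Fin 2 => LocalSplitting.FinLocalSplittings (Fp L) L (IsCMField.complexConj L) n' (complexConj_imagUnit L) (imagUnit_ne_zero L) (imagUnit_mul_self L) (gram (Fp L) e₁ (realDiagonal L dV hdV) (TW (Fp L) (![a, a'] i))) (isSymm_gram (Fp L) e₁ (realDiagonal_isSymm L dV hdV) (isSymm_TW (Fp L) (![a, a'] i))) (reindex_kronecker_eq_gram_map (Fp L) L e₁ (realDiagonal_map L dV hdV).symm (JW_eq (Fp L) L (![a, a'] i)))) (congrW L e₁ dV hdV (lineW L (TW (Fp L) a)) (complexConj_lineW L (TW (Fp L) a)) (realDiagonal_lineW L (TW (Fp L) a)) (diagonal_lineW L (TW (Fp L) a) (JW_eq (Fp L) L a)) (undoubledSplittings L e₁ dV hdV hdV0 (lineW L (TW (Fp L) a)) (complexConj_lineW L (TW (Fp L) a)) (lineW_ne_zero L (TW (Fp L) a) (isUnit_det_TW (Fp L) a)) (toHeckeCharacter L lam) (borelPlaceMeasure L) (cmFinLocalFamily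 L e₁ dV hdV hdV0 (lineW L (TW (Fp L) a)) (complexConj_lineW L (TW (Fp L) a)) (lineW_ne_zero L (TW (Fp L) a) (isUnit_det_TW (Fp L) a)) (toHeckeCharacter L lam) ((isOscillatorChar_toHeckeCharacter_iff lam).mpr hlam) (borelPlaceMeasure L))) (isSymm_TW (Fp L) a) (JW_eq (Fp L) L a)) (Fin.cons (congrW L e₁ dV hdV (lineW L (TW (Fp L) a')) (complexConj_lineW L (TW (Fp L) a')) (realDiagonal_lineW L (TW (Fp L) a')) (diagonal_lineW L (TW (Fp L) a') (JW_eq (Fp L) L a')) (undoubledSplittings L e₁ dV hdV hdV0 (lineW L (TW (Fp L) a')) (complexConj_lineW L (TW (Fp L) a')) (lineW_ne_zero L (TW (Fp L) a') (isUnit_det_TW (Fp L) a')) (toHeckeCharacter L lam') (borelPlaceMeasure L) (cmFinLocalFamily L e₁ dV hdV hdV0 (lineW L (TW (Fp L) a')) (complexConj_lineW L (TW (Fp L) a')) (lineW_ne_zero L (TW (Fp L) a') (isUnit_det_TW (Fp L) a')) (toHeckeCharacter L lam') ((isOscillatorChar_toHeckeCharacter_iff lam').mpr hlam') (borelPlaceMeasure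 L))) (isSymm_TW (Fp L) a') (JW_eq (Fp L) L a')) finZeroElim)) ![localMu L (toHeckeCharacter L lam), localMu L (toHeckeCharacter L lam')]
        (by -- `|μ_v| = 1` for both members (★ `norm_localMu`); the assembler's proof argument here is `norm_localMu_pair L lam lam'`
          refine Fin.cases (fun v x => ?_) (fun k => Fin.cases (fun v x => ?_) (fun l => l.elim0) k)
          · exact norm_localMu L (toHeckeCharacter L lam) v (isUnitary_toHeckeCharacter L lam) x
          · exact norm_localMu L (toHeckeCharacter L lam') v (isUnitary_toHeckeCharacter L lam') x)
        (by -- continuity of `μ_v` for both members (★ `continuous_localMu`); the assembler's argument is `continuous_localMu_pair L lam lam'`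
          refine Fin.cases (fun v => ?_) (fun k => Fin.cases (fun v => ?_) (fun l => l.elim0) k)
          · exact continuous_localMu L (toHeckeCharacter L lam) v
          · exact continuous_localMu L (toHeckeCharacter L lam') v)
        (by -- `ker (μ_v|_{L⁺_vˣ}) = Nm` for both members (★ `localMu_toLocalRing_eq_one_iff`); the assembler's argument is `localMu_pair_toLocalRing_eq_one_iff L lam hlam lam' hlam'`
          refine Fin.cases (fun v t => ?_) (fun k => Fin.cases (fun v t => ?_) (fun l => l.elim0) k)
          · exact localMu_toLocalRing_eq_one_iff L (toHeckeCharacter L lam) v ((isOscillatorChar_toHeckeCharacter_iff lam).mpr hlam) t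
          · exact localMu_toLocalRing_eq_one_iff L (toHeckeCharacter L lam') v ((isOscillatorChar_toHeckeCharacter_iff lam').mpr hlam') t)
        v)

/-- Unfolding of `LemD1_4AsPrintedNonsplitCM₂` (`Iff.rfl`; the letter is consumed by `h : LemD1_4AsPrintedNonsplitCM₂` applied to the data).
[cite: Liu2021, App. D Lem. D.1 (4) (p. 126, TeX l. 5235)] -/
theorem lemD1_4AsPrintedNonsplitCM₂_iff : LemD1_4AsPrintedNonsplitCM₂ ↔
  ∀ (L : Type) [Field L] [NumberField L] [IsCMField L]
      (dV : Fin 2 → L) (hdV : ∀ i, IsCMField.complexConj L (dV i) = dV i) (hdV0 : ∀ i, dV i ≠ 0)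
      {n' : ℕ} (e₁ : Fin 2 × Fin 1 ≃ Fin n')
      (lam : Literature.NumberTheory.Automorphic.IdeleClassGroup L →ₜ* Circle) (hlam : IsConjugateSymplectic L lam)
      (a : (↥(maximalRealSubfield L))ˣ) (χ : Chi (↥(maximalRealSubfield L)) L (IsCMField.complexConj L)) (a' : (↥(maximalRealSubfield L))ˣ)
      (lam' : Literature.NumberTheory.Automorphic.IdeleClassGroup L →ₜ* Circle) (hlam' : IsConjugateSymplectic L lam')
      (hcc : IsCMField.complexConj L * IsCMField.complexConj L = 1),
      toHeckeCharacter L lam' =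
        toHeckeCharacter L (IdeleClassGroup.galConj (IsCMField.complexConj L) lam) * HeckeCharacter.checkOfChi hcc χ →
    ∀ (v : HeightOneSpectrum (𝓞 ↥(maximalRealSubfield L))),
      (∀ w : UnitaryGroup.PlacesOver L v, IsCMField.complexConj L • (w : HeightOneSpectrum (𝓞 L)) = w) →
      LemD1_4AsPrintedI (localIndexedFamilyAtV₂ (Fp L) L (IsCMField.complexConj L) 2 e₁ (Matrix.diagonal dV) (complexConj_imagUnit L) (imagUnit_ne_zero L) (imagUnit_mul_self L) (realDiagonal_isSymm L dV hdV) (isUnit_det_realDiagonal L dV hdV hdV0) (realDiagonal_map L dV hdV).symm (by -- `2 ≤ n'` (§D.1 «rank n ≥ 2»); the assembler's proof argument here is `two_le_of_finTwo_equiv e₁`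
          have h := Fintype.card_congr e₁
          simp only [Fintype.card_prod, Fintype.card_fin, mul_one] at h
          omega) ![a, a'] (fun _ => χ) (Fin.cons (α := fun i : Fin 2 => LocalSplitting.FinLocalSplittings (Fp L) L (IsCMField.complexConj L) n' (complexConj_imagUnit L) (imagUnit_ne_zero L) (imagUnit_mul_self L) (gram (Fp L) e₁ (realDiagonal L dV hdV) (TW (Fp L) (![a, a'] i))) (isSymm_gram (Fp L) e₁ (realDiagonal_isSymm L dV hdV) (isSymm_TW (Fp L) (![a, a'] i))) (reindex_kronecker_eq_gram_map (Fp L) L e₁ (realDiagonal_map L dV hdV).symm (JW_eq (Fp L) L (![a, a'] i)))) (congrW L e₁ dV hdV (lineW L (TW (Fp L) a)) (complexConj_lineW L (TW (Fp L) a)) (realDiagonal_lineW L (TW (Fp L) a)) (diagonal_lineW L (TW (Fp L) a) (JW_eq (Fp L) L a)) (undoubledSplittings L e₁ dV hdV hdV0 (lineW L (TW (Fp L) a)) (complexConj_lineW L (TW (Fp L) a)) (lineW_ne_zero L (TW (Fp L) a) (isUnit_det_TW (Fp L) a)) (toHeckeCharacter L lam) (borelPlaceMeasure L) (cmFinLocalFamily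 L e₁ dV hdV hdV0 (lineW L (TW (Fp L) a)) (complexConj_lineW L (TW (Fp L) a)) (lineW_ne_zero L (TW (Fp L) a) (isUnit_det_TW (Fp L) a)) (toHeckeCharacter L lam) ((isOscillatorChar_toHeckeCharacter_iff lam).mpr hlam) (borelPlaceMeasure L))) (isSymm_TW (Fp L) a) (JW_eq (Fp L) L a)) (Fin.cons (congrW L e₁ dV hdV (lineW L (TW (Fp L) a')) (complexConj_lineW L (TW (Fp L) a')) (realDiagonal_lineW L (TW (Fp L) a')) (diagonal_lineW L (TW (Fp L) a') (JW_eq (Fp L) L a')) (undoubledSplittings L e₁ dV hdV hdV0 (lineW L (TW (Fp L) a')) (complexConj_lineW L (TW (Fp L) a')) (lineW_ne_zero L (TW (Fp L) a') (isUnit_det_TW (Fp L) a')) (toHeckeCharacter L lam') (borelPlaceMeasure L) (cmFinLocalFamily L e₁ dV hdV hdV0 (lineW L (TW (Fp L) a')) (complexConj_lineW L (TW (Fp L) a')) (lineW_ne_zero L (TW (Fp L) a') (isUnit_det_TW (Fp L) a')) (toHeckeCharacter L lam') ((isOscillatorChar_toHeckeCharacter_iff lam').mpr hlam') (borelPlaceMeasure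 L))) (isSymm_TW (Fp L) a') (JW_eq (Fp L) L a')) finZeroElim)) ![localMu L (toHeckeCharacter L lam), localMu L (toHeckeCharacter L lam')]
        (by -- `|μ_v| = 1` for both members (★ `norm_localMu`); the assembler's proof argument here is `norm_localMu_pair L lam lam'`
          refine Fin.cases (fun v x => ?_) (fun k => Fin.cases (fun v x => ?_) (fun l => l.elim0) k)
          · exact norm_localMu L (toHeckeCharacter L lam) v (isUnitary_toHeckeCharacter L lam) x
          · exact norm_localMu L (toHeckeCharacter L lam') v (isUnitary_toHeckeCharacter L lam') x)
        (by -- continuity of `μ_v` for both members (★ `continuous_localMu`); the assembler's argument is `continuous_localMu_pair L lam lam'`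
          refine Fin.cases (fun v => ?_) (fun k => Fin.cases (fun v => ?_) (fun l => l.elim0) k)
          · exact continuous_localMu L (toHeckeCharacter L lam) v
          · exact continuous_localMu L (toHeckeCharacter L lam') v)
        (by -- `ker (μ_v|_{L⁺_vˣ}) = Nm` for both members (★ `localMu_toLocalRing_eq_one_iff`); the assembler's argument is `localMu_pair_toLocalRing_eq_one_iff L lam hlam lam' hlam'`
          refine Fin.cases (fun v t => ?_) (fun k => Fin.cases (fun v t => ?_) (fun l => l.elim0) k)
          · exact localMu_toLocalRing_eq_one_iff L (toHeckeCharacter L lam) v ((isOscillatorChar_toHeckeCharacter_iff lam).mpr hlam) t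
          · exact localMu_toLocalRing_eq_one_iff L (toHeckeCharacter L lam') v ((isOscillatorChar_toHeckeCharacter_iff lam').mpr hlam') t)
        v) :=
  Iff.rfl

/-- **[Liu2021, App. D, Lemma D.1, first sentence and item (1)] AS PRINTED ON THE RANK-2 CM θ-PACKAGE `(λ′, a′, χ)` AT EVERY FINITE PLACE** —
Y. Liu, Camb. J. Math. 9 (2021), Lemma D.1, p. 125 (TeX l. 5227–5229): «Suppose that `F` is nonarchimedean. Then `ω(μ, ε, χ)` is irreducible and
admissible. Moreover, (1) `ω(μ, ε, χ)` is zero if and only if `E` is a field, `V` is anisotropic (in particular `n = 2`), and `χ̌ = μ²`.» — typed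
as ★ `LemD1_1AsPrinted` of the datum ★ `localLemD1DataAtV₂ … a′ 𝓢_λ′,a′ (two_le …) (localMu L (toHeckeCharacter L λ′)) … χ v` for: every CM
field `L`, real non-zero frame `dV : Fin 2 → L`, `e₁ : Fin 2 × Fin 1 ≃ Fin n'`, central character `χ`, line `a′ ∈ L⁺ˣ`, conjugate-symplectic
idèle class character `λ′` of `L`, and every finite place `v` of `L⁺`.  The binder type `h1` of the R2′ assembler head ★ `companionRelabelTransfer₂_of_nonsplit_lemD1_4`, token for token outside the one inlined proof argument (`2 ≤ n'`).  A NAMED FACT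
(not proved here).
[cite: Liu2021, App. D Lem. D.1 (1) (p. 125, TeX l. 5227–5229); §D.1 Steps 1–3 (l. 5217–5221)] -/
def LemD1_1AsPrintedCM₂ : Prop :=
  ∀ (L : Type) [Field L] [NumberField L] [IsCMField L]
      (dV : Fin 2 → L) (hdV : ∀ i, IsCMField.complexConj L (dV i) = dV i) (hdV0 : ∀ i, dV i ≠ 0)
      {n' : ℕ} (e₁ : Fin 2 × Fin 1 ≃ Fin n')
      (χ : Chi (↥(maximalRealSubfield L)) L (IsCMField.complexConj L)) (a' : (↥(maximalRealSubfield L))ˣ)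
      (lam' : Literature.NumberTheory.Automorphic.IdeleClassGroup L →ₜ* Circle) (hlam' : IsConjugateSymplectic L lam')
      (v : HeightOneSpectrum (𝓞 ↥(maximalRealSubfield L))),
      LemD1_1AsPrinted (localLemD1DataAtV₂ (Fp L) L (IsCMField.complexConj L) 2 e₁ (Matrix.diagonal dV) (complexConj_imagUnit L)
        (imagUnit_ne_zero L) (imagUnit_mul_self L) (realDiagonal_isSymm L dV hdV) (isUnit_det_realDiagonal L dV hdV hdV0)
        (realDiagonal_map L dV hdV).symm a' (congrW L e₁ dV hdV (lineW L (TW (Fp L) a')) (complexConj_lineW L (TW (Fp L) a')) (realDiagonal_lineW L (TW (Fp L) a')) (diagonal_lineW L (TW (Fp L) a') (JW_eq (Fp L) L a')) (undoubledSplittings L e₁ dV hdV hdV0 (lineW L (TW (Fp L) a')) (complexConj_lineW L (TW (Fp L) a')) (lineW_ne_zero L (TW (Fp L) a') (isUnit_det_TW (Fp L) a')) (toHeckeCharacter L lam') (borelPlaceMeasure L) (cmFinLocalFamily L e₁ dV hdV hdV0 (lineW L (TW (Fp L) a')) (complexConj_lineW L (TW (Fp L) a')) (lineW_ne_zero L (TW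 (Fp L) a') (isUnit_det_TW (Fp L) a')) (toHeckeCharacter L lam') ((isOscillatorChar_toHeckeCharacter_iff lam').mpr hlam') (borelPlaceMeasure L))) (isSymm_TW (Fp L) a') (JW_eq (Fp L) L a')) (by -- `2 ≤ n'` (§D.1 «rank n ≥ 2»); the assembler's proof argument here is `two_le_of_finTwo_equiv e₁`
          have h := Fintype.card_congr e₁
          simp only [Fintype.card_prod, Fintype.card_fin, mul_one] at h
          omega)
        (localMu L (toHeckeCharacter L lam')) (fun v x => norm_localMu L (toHeckeCharacter L lam') v (isUnitary_toHeckeCharacter L lam') x)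
        (continuous_localMu L (toHeckeCharacter L lam'))
        (fun v t => localMu_toLocalRing_eq_one_iff L (toHeckeCharacter L lam') v ((isOscillatorChar_toHeckeCharacter_iff lam').mpr hlam') t)
        χ v)

/-- Unfolding of `LemD1_1AsPrintedCM₂` (`Iff.rfl`). [cite: Liu2021, App. D Lem. D.1 (1) (p. 125, TeX l. 5229)] -/
theorem lemD1_1AsPrintedCM₂_iff : LemD1_1AsPrintedCM₂ ↔
  ∀ (L : Type) [Field L] [NumberField L] [IsCMField L]
      (dV : Fin 2 → L) (hdV : ∀ i, IsCMField.complexConj L (dV i) = dV i) (hdV0 : ∀ i, dV i ≠ 0)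
      {n' : ℕ} (e₁ : Fin 2 × Fin 1 ≃ Fin n')
      (χ : Chi (↥(maximalRealSubfield L)) L (IsCMField.complexConj L)) (a' : (↥(maximalRealSubfield L))ˣ)
      (lam' : Literature.NumberTheory.Automorphic.IdeleClassGroup L →ₜ* Circle) (hlam' : IsConjugateSymplectic L lam')
      (v : HeightOneSpectrum (𝓞 ↥(maximalRealSubfield L))),
      LemD1_1AsPrinted (localLemD1DataAtV₂ (Fp L) L (IsCMField.complexConj L) 2 e₁ (Matrix.diagonal dV) (complexConj_imagUnit L)
        (imagUnit_ne_zero L) (imagUnit_mul_self L) (realDiagonal_isSymm L dV hdV) (isUnit_det_realDiagonal L dV hdV hdV0)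
        (realDiagonal_map L dV hdV).symm a' (congrW L e₁ dV hdV (lineW L (TW (Fp L) a')) (complexConj_lineW L (TW (Fp L) a')) (realDiagonal_lineW L (TW (Fp L) a')) (diagonal_lineW L (TW (Fp L) a') (JW_eq (Fp L) L a')) (undoubledSplittings L e₁ dV hdV hdV0 (lineW L (TW (Fp L) a')) (complexConj_lineW L (TW (Fp L) a')) (lineW_ne_zero L (TW (Fp L) a') (isUnit_det_TW (Fp L) a')) (toHeckeCharacter L lam') (borelPlaceMeasure L) (cmFinLocalFamily L e₁ dV hdV hdV0 (lineW L (TW (Fp L) a')) (complexConj_lineW L (TW (Fp L) a')) (lineW_ne_zero L (TW (Fp L) a') (isUnit_det_TW (Fp L) a')) (toHeckeCharacter L lam') ((isOscillatorChar_toHeckeCharacter_iff lam').mpr hlam') (borelPlaceMeasure L))) (isSymm_TW (Fp L) a') (JW_eq (Fp L) L a')) (by -- `2 ≤ n'` (§D.1 «rank n ≥ 2»); the assembler's proof argument here is `two_le_of_finTwo_equiv e₁`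
          have h := Fintype.card_congr e₁
          simp only [Fintype.card_prod, Fintype.card_fin, mul_one] at h
          omega)
        (localMu L (toHeckeCharacter L lam')) (fun v x => norm_localMu L (toHeckeCharacter L lam') v (isUnitary_toHeckeCharacter L lam') x)
        (continuous_localMu L (toHeckeCharacter L lam'))
        (fun v t => localMu_toLocalRing_eq_one_iff L (toHeckeCharacter L lam') v ((isOscillatorChar_toHeckeCharacter_iff lam').mpr hlam') t)
        χ v) :=
  Iff.rfl


/-! ## EDITION 2 (append-only) — the THIRD letter: [Lem. D.1, first sentence + (1)] AS PRINTED at the NON-SPLIT finite places only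

Row owner F0P5-plan (g4), cell bus 2026-08-31T18:23:00Z: the `h1` CUT.  The SPLIT places of `LemD1_1AsPrintedCM₂` are an in-house
THEOREM (★ `Def411WeilCarriers.lemD1_1AsPrinted_localLemD1DataAtV₂_of_not_isField`, B-p04 (g30) p830397; CM packaging ★
`…_cmFinLocalFamily_of_split` ∕ `…_cmFinLocalFamily_of_forall_nonsplit`, A-p18 (g22) p830883), so the letter the pay-down line has to CITE is
only the non-split text: the binder `h1ns` of ★ `Summit.….F0P5CurveThetaCompanionRelabelOfNonsplitLetters.companionRelabelTransfer₂_of_nonsplit_letters`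
(A-p17 (g18), p830977; tree file `Summits/HodgeConjecture/HodgeConjecture/Theorems/F0P5CurveThetaCompanionRelabelOfNonsplitLetters.lean` sha16
`743290c4d96ec00b` :126–:133) = `h1` plus ONE guard `(∀ w : UnitaryGroup.PlacesOver L v, IsCMField.complexConj L • (w : …) = w) →` after the
place binder.  As in §«β» above, the body below is that binder type TOKEN FOR TOKEN outside the one proof argument `(two_le_of_finTwo_equiv e₁)`,
inlined as the same `omega` block.  Bookkeeping (proved): the all-places letter implies the non-split letter (`LemD1_1AsPrintedCM₂.toNonsplit`) and — because the SPLIT places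
are the in-house theorem ★ `lemD1_1AsPrinted_localLemD1DataAtV₂_cmFinLocalFamily_of_split` — conversely (`LemD1_1AsPrintedNonsplitCM₂.toAllPlaces`,
via ★ `…_cmFinLocalFamily_of_forall_nonsplit`; +1 import ★ `Liu2021.LemD1Item1AtV2OfSplitCM`), so `lemD1_1AsPrintedCM₂_iff_nonsplit : LemD1_1AsPrintedCM₂ ↔
LemD1_1AsPrintedNonsplitCM₂` — the two names are ONE printed statement for the books. -/

/-- **[Liu2021, App. D, Lemma D.1, first sentence and item (1)] AS PRINTED ON THE RANK-2 CM θ-PACKAGE `(λ′, a′, χ)` AT THE NON-SPLIT FINITE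
PLACES** — Y. Liu, Camb. J. Math. 9 (2021), Lemma D.1, p. 125 (TeX l. 5227–5229): «Suppose that `F` is nonarchimedean. Then `ω(μ, ε, χ)` is
irreducible and admissible. Moreover, (1) `ω(μ, ε, χ)` is zero if and only if `E` is a field, `V` is anisotropic (in particular `n = 2`), and
`χ̌ = μ²`.» — typed as ★ `LemD1_1AsPrinted` of the datum ★ `localLemD1DataAtV₂ … a′ 𝓢_λ′,a′ … (localMu L (toHeckeCharacter L λ′)) … χ v` for: every
CM field `L`, real non-zero frame `dV : Fin 2 → L`, `e₁ : Fin 2 × Fin 1 ≃ Fin n'`, central character `χ`, line `a′ ∈ L⁺ˣ`, conjugate-symplectic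
idèle class character `λ′` of `L`, and every finite place `v` of `L⁺` that is NOT SPLIT in `L` (`∀ w ∣ v, c • w = w`: there `E = L_v` IS a field,
the case the printed item (1) is about).  The binder type `h1ns` of ★ `companionRelabelTransfer₂_of_nonsplit_letters`, token for token outside the
one inlined proof argument (`2 ≤ n'`).  WEAKER than `LemD1_1AsPrintedCM₂` (fewer places).  A NAMED FACT (not proved here).
[cite: Liu2021, App. D Lem. D.1 (1) (p. 125, TeX l. 5227–5229); §D.1 Steps 1–3 (l. 5217–5221)] -/
def LemD1_1AsPrintedNonsplitCM₂ : Prop :=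
  ∀ (L : Type) [Field L] [NumberField L] [IsCMField L]
      (dV : Fin 2 → L) (hdV : ∀ i, IsCMField.complexConj L (dV i) = dV i) (hdV0 : ∀ i, dV i ≠ 0)
      {n' : ℕ} (e₁ : Fin 2 × Fin 1 ≃ Fin n')
      (χ : Chi (↥(maximalRealSubfield L)) L (IsCMField.complexConj L)) (a' : (↥(maximalRealSubfield L))ˣ)
      (lam' : Literature.NumberTheory.Automorphic.IdeleClassGroup L →ₜ* Circle) (hlam' : IsConjugateSymplectic L lam')
      (v : HeightOneSpectrum (𝓞 ↥(maximalRealSubfield L))),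
      (∀ w : UnitaryGroup.PlacesOver L v, IsCMField.complexConj L • (w : HeightOneSpectrum (𝓞 L)) = w) →
      LemD1_1AsPrinted (localLemD1DataAtV₂ (Fp L) L (IsCMField.complexConj L) 2 e₁ (Matrix.diagonal dV) (complexConj_imagUnit L)
        (imagUnit_ne_zero L) (imagUnit_mul_self L) (realDiagonal_isSymm L dV hdV) (isUnit_det_realDiagonal L dV hdV hdV0)
        (realDiagonal_map L dV hdV).symm a' (congrW L e₁ dV hdV (lineW L (TW (Fp L) a')) (complexConj_lineW L (TW (Fp L) a')) (realDiagonal_lineW L (TW (Fp L) a')) (diagonal_lineW L (TW (Fp L) a') (JW_eq (Fp L) L a')) (undoubledSplittings L e₁ dV hdV hdV0 (lineW L (TW (Fp L) a')) (complexConj_lineW L (TW (Fp L) a')) (lineW_ne_zero L (TW (Fp L) a') (isUnit_det_TW (Fp L) a')) (toHeckeCharacter L lam') (borelPlaceMeasure L) (cmFinLocalFamily L e₁ dV hdV hdV0 (lineW L (TW (Fp L) a')) (complexConj_lineW L (TW (Fp L) a')) (lineW_ne_zero L (TW (Fp L) a') (isUnit_det_TW (Fp L) a')) (toHeckeCharacter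 L lam') ((isOscillatorChar_toHeckeCharacter_iff lam').mpr hlam') (borelPlaceMeasure L))) (isSymm_TW (Fp L) a') (JW_eq (Fp L) L a')) (by -- `2 ≤ n'` (§D.1 «rank n ≥ 2»); the assembler's proof argument here is `two_le_of_finTwo_equiv e₁`
          have h := Fintype.card_congr e₁
          simp only [Fintype.card_prod, Fintype.card_fin, mul_one] at h
          omega)
        (localMu L (toHeckeCharacter L lam')) (fun v x => norm_localMu L (toHeckeCharacter L lam') v (isUnitary_toHeckeCharacter L lam') x)
        (continuous_localMu L (toHeckeCharacter L lam'))
        (fun v t => localMu_toLocalRing_eq_one_iff L (toHeckeCharacter L lam') v ((isOscillatorChar_toHeckeCharacter_iff lam').mpr hlam') t)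
        χ v)

/-- Unfolding of `LemD1_1AsPrintedNonsplitCM₂` (`Iff.rfl`). [cite: Liu2021, App. D Lem. D.1 (1) (p. 125, TeX l. 5229)] -/
theorem lemD1_1AsPrintedNonsplitCM₂_iff : LemD1_1AsPrintedNonsplitCM₂ ↔
  ∀ (L : Type) [Field L] [NumberField L] [IsCMField L]
      (dV : Fin 2 → L) (hdV : ∀ i, IsCMField.complexConj L (dV i) = dV i) (hdV0 : ∀ i, dV i ≠ 0)
      {n' : ℕ} (e₁ : Fin 2 × Fin 1 ≃ Fin n')
      (χ : Chi (↥(maximalRealSubfield L)) L (IsCMField.complexConj L)) (a' : (↥(maximalRealSubfield L))ˣ)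
      (lam' : Literature.NumberTheory.Automorphic.IdeleClassGroup L →ₜ* Circle) (hlam' : IsConjugateSymplectic L lam')
      (v : HeightOneSpectrum (𝓞 ↥(maximalRealSubfield L))),
      (∀ w : UnitaryGroup.PlacesOver L v, IsCMField.complexConj L • (w : HeightOneSpectrum (𝓞 L)) = w) →
      LemD1_1AsPrinted (localLemD1DataAtV₂ (Fp L) L (IsCMField.complexConj L) 2 e₁ (Matrix.diagonal dV) (complexConj_imagUnit L)
        (imagUnit_ne_zero L) (imagUnit_mul_self L) (realDiagonal_isSymm L dV hdV) (isUnit_det_realDiagonal L dV hdV hdV0)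
        (realDiagonal_map L dV hdV).symm a' (congrW L e₁ dV hdV (lineW L (TW (Fp L) a')) (complexConj_lineW L (TW (Fp L) a')) (realDiagonal_lineW L (TW (Fp L) a')) (diagonal_lineW L (TW (Fp L) a') (JW_eq (Fp L) L a')) (undoubledSplittings L e₁ dV hdV hdV0 (lineW L (TW (Fp L) a')) (complexConj_lineW L (TW (Fp L) a')) (lineW_ne_zero L (TW (Fp L) a') (isUnit_det_TW (Fp L) a')) (toHeckeCharacter L lam') (borelPlaceMeasure L) (cmFinLocalFamily L e₁ dV hdV hdV0 (lineW L (TW (Fp L) a')) (complexConj_lineW L (TW (Fp L) a')) (lineW_ne_zero L (TW (Fp L) a') (isUnit_det_TW (Fp L) a')) (toHeckeCharacter L lam') ((isOscillatorChar_toHeckeCharacter_iff lam').mpr hlam') (borelPlaceMeasure L))) (isSymm_TW (Fp L) a') (JW_eq (Fp L) L a')) (by -- `2 ≤ n'` (§D.1 «rank n ≥ 2»); the assembler's proof argument here is `two_le_of_finTwo_equiv e₁`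
          have h := Fintype.card_congr e₁
          simp only [Fintype.card_prod, Fintype.card_fin, mul_one] at h
          omega)
        (localMu L (toHeckeCharacter L lam')) (fun v x => norm_localMu L (toHeckeCharacter L lam') v (isUnitary_toHeckeCharacter L lam') x)
        (continuous_localMu L (toHeckeCharacter L lam'))
        (fun v t => localMu_toLocalRing_eq_one_iff L (toHeckeCharacter L lam') v ((isOscillatorChar_toHeckeCharacter_iff lam').mpr hlam') t)
        χ v) :=
  Iff.rfl

/-- Bookkeeping (proved): the all-places letter `LemD1_1AsPrintedCM₂` implies the non-split letter `LemD1_1AsPrintedNonsplitCM₂` (drop the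
guard). [cite: Liu2021, App. D Lem. D.1 (1) (p. 125, TeX l. 5229)] -/
theorem LemD1_1AsPrintedCM₂.toNonsplit (h : LemD1_1AsPrintedCM₂) : LemD1_1AsPrintedNonsplitCM₂ :=
  fun L _ _ _ dV hdV hdV0 _ e₁ χ a' lam' hlam' v _ => h L dV hdV hdV0 e₁ χ a' lam' hlam' v


/-- Bookkeeping (proved): the non-split letter already gives the all-places letter — at a SPLIT place item (1) is the in-house theorem
★ `Def411WeilCarriers.lemD1_1AsPrinted_localLemD1DataAtV₂_cmFinLocalFamily_of_split` (A-p18 (g22) p830883, on ★ B-p04 (g30) p830397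
`…_of_not_isField`), assembled with the letter by ★ `…_cmFinLocalFamily_of_forall_nonsplit`.  So the two booked names `LemD1_1AsPrintedCM₂` and
`LemD1_1AsPrintedNonsplitCM₂` are ONE printed statement for the books (`lemD1_1AsPrintedCM₂_iff_nonsplit`).
[cite: Liu2021, App. D Lem. D.1 (1) (p. 125, TeX l. 5229); proof of Lemma D.1, first paragraph (l. 5241)] -/
theorem LemD1_1AsPrintedNonsplitCM₂.toAllPlaces (h : LemD1_1AsPrintedNonsplitCM₂) : LemD1_1AsPrintedCM₂ :=
  fun L _ _ _ dV hdV hdV0 _ e₁ χ a' lam' hlam' v =>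
    lemD1_1AsPrinted_localLemD1DataAtV₂_cmFinLocalFamily_of_forall_nonsplit L e₁ dV hdV hdV0 (toHeckeCharacter L lam')
      (isUnitary_toHeckeCharacter L lam') ((isOscillatorChar_toHeckeCharacter_iff lam').mpr hlam') (borelPlaceMeasure L) a' χ _
      (localMu L (toHeckeCharacter L lam')) _ _ _ (fun v hv => h L dV hdV hdV0 e₁ χ a' lam' hlam' v hv) v

/-- The two `Lem. D.1 (1)` letters of this file are EQUIVALENT in the tree (count-neutral re-denomination for the books).
[cite: Liu2021, App. D Lem. D.1 (1) (p. 125, TeX l. 5229)] -/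
theorem lemD1_1AsPrintedCM₂_iff_nonsplit : LemD1_1AsPrintedCM₂ ↔ LemD1_1AsPrintedNonsplitCM₂ :=
  ⟨LemD1_1AsPrintedCM₂.toNonsplit, LemD1_1AsPrintedNonsplitCM₂.toAllPlaces⟩

end Literature.NumberTheory.Automorphic.Liu2021.LemD1RankTwoCMLetters

/-! ## EDITION 3 (append-only) — the FIFTH letter «L4-if»: [Lem. D.1 (4)], «IF» direction, second alternative, at the NON-SPLIT places

Row owner F0P5-plan (g4), cell bus 2026-08-31T19:17:49Z (i) (L1 ELIMINATION; R2′-L ED. 3 = «L4-if» only; shape agreed with A-p17 (g18)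
19:04:21Z).  The R2′ assembler consumes ONLY the «if» direction of the printed equivalence (4), and of it only the SECOND alternative
(`μ′ = μᶜ·χ̌`, `χ′ = χ`, `ε′ ~ ε` iff `V` isotropic) at one ordered pair of members — exactly ★ `LemD1_4AsPrintedI.areIsomorphicRep_of_muTwist`
(A-p17 (g18) 19:03:13Z (a)).  This edition names that reading: the GENERIC predicate `LemD1_4IfAsPrintedI Lf` (sibling of ★ `LemD1_4AsPrintedI`,
same binders, same `letI`; body = the hypotheses of ★ `areIsomorphicRep_of_muTwist` in their order, then its conclusion — a predicate with body,
nothing asserted) with the projection `LemD1_4AsPrintedI.toIf`, and the fifth letter `LemD1_4IfAsPrintedNonsplitCM₂` = the body of ★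
`LemD1_4AsPrintedNonsplitCM₂` with the ONE head token `LemD1_4AsPrintedI` ↦ `LemD1_4IfAsPrintedI` (+ `LemD1_4AsPrintedNonsplitCM₂.toIf`).
WEAKER than `LemD1_4AsPrintedNonsplitCM₂`, hence than print.  What is left of [Lem. D.1 (4)] in this letter is the rank-one theta dichotomy
at a non-split place ([HarrisKudlaSweet1996, Thm. 6.1]; Liu's proof l. 5257–5261 via [GGP2, §8]). -/

namespace Literature.NumberTheory.Automorphic.Liu2021

/-- **[Liu2021, App. D, Lemma D.1 (4)], «IF» DIRECTION, SECOND ALTERNATIVE, on an indexed collection** (READING I3, as ★ `LemD1_4AsPrintedI`) —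
l. 5235: «If `n = 2` and `ω(μ, ε, χ)` is nonzero, then `ω(μ′, ε′, χ′)` is isomorphic to `ω(μ, ε, χ)` if … `μ′ = μ^c χ̌`, `χ′ = χ`, and `ε′ = ε`
(resp. `ε′ ≠ ε`) when `V` is isotropic (resp. anisotropic).»: for `n = 2`, every member `i` with `ω(μ_i, ε_i, χ_i)` non-zero and every member
`j` with `μ_j = μ_iᶜ·χ̌_i` (★ `LemD1.muTwist`), `χ_j = χ_i`, (`V` isotropic → `ε_j ~ ε_i`), (`V` anisotropic → `ε_j ≁ ε_i`): `ω_j ≅ ω_i`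
(★ `AreIsomorphicRep`) — the hypotheses of ★ `LemD1_4AsPrintedI.areIsomorphicRep_of_muTwist` in their order.  A predicate on `Lf`; not asserted;
WEAKER than ★ `LemD1_4AsPrintedI Lf` (`LemD1_4AsPrintedI.toIf`). [cite: Liu2021, App. D Lem. D.1 (4) (p. 126, TeX l. 5235)] -/
def LemD1_4IfAsPrintedI {F E : Type} [Field F] [ValuativeRel F] [TopologicalSpace F] [CommRing E] [Algebra F E]
    [TopologicalSpace E] [IsTopologicalRing E] {n : ℕ} {ι : Type} (Lf : LemD1IndexedFamily F E n ι) : Prop :=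
  letI : IsModuleTopology F E := Lf.isModuleTopology
  n = 2 → ∀ i : ι, Nontrivial (Lf.V i ⧸ CentralCharacterQuotient.augmentation (Lf.omega i) Lf.S.scalar (Lf.chi i).1) → ∀ j : ι,
    Lf.mu j = LemD1.muTwist (Lf.mu i) (Lf.chi i) → Lf.chi j = Lf.chi i →
      (LemD1.IsIsotropic Lf.S → LemD1.SameClass (Lf.eps i) (Lf.eps j)) →
      (¬ LemD1.IsIsotropic Lf.S → ¬ LemD1.SameClass (Lf.eps i) (Lf.eps j)) → AreIsomorphicRep (Lf.quot j) (Lf.quot i)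

/-- The printed equivalence (4) (READING I3) implies its «if» direction, second alternative (= ★ `areIsomorphicRep_of_muTwist`).
[cite: Liu2021, App. D Lem. D.1 (4) (p. 126, TeX l. 5235)] -/
theorem LemD1_4AsPrintedI.toIf {F E : Type} [Field F] [ValuativeRel F] [TopologicalSpace F] [CommRing E] [Algebra F E]
    [TopologicalSpace E] [IsTopologicalRing E] {n : ℕ} {ι : Type} {Lf : LemD1IndexedFamily F E n ι} (h : LemD1_4AsPrintedI Lf) :
    LemD1_4IfAsPrintedI Lf :=
  fun hn _ hi _ hμ hχ hiso han => h.areIsomorphicRep_of_muTwist hn hi hμ hχ hiso han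

end Literature.NumberTheory.Automorphic.Liu2021

namespace Literature.NumberTheory.Automorphic.Liu2021.LemD1RankTwoCMLetters

/-- **[Liu2021, App. D, Lemma D.1 (4)], «IF» DIRECTION, SECOND ALTERNATIVE (READING I3) ON THE TWO MEMBERS `(λ, a, χ)`, `(λ′, a′, χ)` OF THE
RANK-2 CM θ-PACKAGE FAMILY AT THE NON-SPLIT FINITE PLACES** — the body of ★ `LemD1_4AsPrintedNonsplitCM₂` (ED. 1, = binder `h4` of ★
`companionRelabelTransfer₂_of_nonsplit_lemD1_4` token for token outside the four inlined proof arguments) with the ONE head token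
`LemD1_4AsPrintedI` ↦ `LemD1_4IfAsPrintedI`: every CM field `L`, real non-zero frame `dV`, `e₁`, conjugate-symplectic `λ, λ′` with `λ′ = λᶜ · χ̌`
as Hecke characters, lines `a, a′`, central character `χ`, finite place `v` of `L⁺` with `c • w = w` for all `w ∣ v`.  The letter the R2′ assembler
actually consumes (A-p17 (g18), `Theorems/F0P5CurveThetaCompanionRelabelOfNonsplitIfLetter.lean`, binder `h4if` BY NAME).  WEAKER than
`LemD1_4AsPrintedNonsplitCM₂` (`LemD1_4AsPrintedNonsplitCM₂.toIf`).  A NAMED FACT (not proved here): its content at a non-split place is the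
rank-one theta dichotomy [HarrisKudlaSweet1996, Thm. 6.1]. [cite: Liu2021, App. D Lem. D.1 (4) (p. 126, TeX l. 5235); §D.1 Steps 1–3 (l. 5217–5221)]
[cite: HarrisKudlaSweet1996, Thm. 6.1] -/
def LemD1_4IfAsPrintedNonsplitCM₂ : Prop :=
  ∀ (L : Type) [Field L] [NumberField L] [IsCMField L]
      (dV : Fin 2 → L) (hdV : ∀ i, IsCMField.complexConj L (dV i) = dV i) (hdV0 : ∀ i, dV i ≠ 0)
      {n' : ℕ} (e₁ : Fin 2 × Fin 1 ≃ Fin n')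
      (lam : Literature.NumberTheory.Automorphic.IdeleClassGroup L →ₜ* Circle) (hlam : IsConjugateSymplectic L lam)
      (a : (↥(maximalRealSubfield L))ˣ) (χ : Chi (↥(maximalRealSubfield L)) L (IsCMField.complexConj L)) (a' : (↥(maximalRealSubfield L))ˣ)
      (lam' : Literature.NumberTheory.Automorphic.IdeleClassGroup L →ₜ* Circle) (hlam' : IsConjugateSymplectic L lam')
      (hcc : IsCMField.complexConj L * IsCMField.complexConj L = 1),
      toHeckeCharacter L lam' =
        toHeckeCharacter L (IdeleClassGroup.galConj (IsCMField.complexConj L) lam) * HeckeCharacter.checkOfChi hcc χ →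
    ∀ (v : HeightOneSpectrum (𝓞 ↥(maximalRealSubfield L))),
      (∀ w : UnitaryGroup.PlacesOver L v, IsCMField.complexConj L • (w : HeightOneSpectrum (𝓞 L)) = w) →
      LemD1_4IfAsPrintedI (localIndexedFamilyAtV₂ (Fp L) L (IsCMField.complexConj L) 2 e₁ (Matrix.diagonal dV) (complexConj_imagUnit L) (imagUnit_ne_zero L) (imagUnit_mul_self L) (realDiagonal_isSymm L dV hdV) (isUnit_det_realDiagonal L dV hdV hdV0) (realDiagonal_map L dV hdV).symm (by -- `2 ≤ n'` (§D.1 «rank n ≥ 2»); the assembler's proof argument here is `two_le_of_finTwo_equiv e₁`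
          have h := Fintype.card_congr e₁
          simp only [Fintype.card_prod, Fintype.card_fin, mul_one] at h
          omega) ![a, a'] (fun _ => χ) (Fin.cons (α := fun i : Fin 2 => LocalSplitting.FinLocalSplittings (Fp L) L (IsCMField.complexConj L) n' (complexConj_imagUnit L) (imagUnit_ne_zero L) (imagUnit_mul_self L) (gram (Fp L) e₁ (realDiagonal L dV hdV) (TW (Fp L) (![a, a'] i))) (isSymm_gram (Fp L) e₁ (realDiagonal_isSymm L dV hdV) (isSymm_TW (Fp L) (![a, a'] i))) (reindex_kronecker_eq_gram_map (Fp L) L e₁ (realDiagonal_map L dV hdV).symm (JW_eq (Fp L) L (![a, a'] i)))) (congrW L e₁ dV hdV (lineW L (TW (Fp L) a)) (complexConj_lineW L (TW (Fp L) a)) (realDiagonal_lineW L (TW (Fp L) a)) (diagonal_lineW L (TW (Fp L) a) (JW_eq (Fp L) L a)) (undoubledSplittings L e₁ dV hdV hdV0 (lineW L (TW (Fp L) a)) (complexConj_lineW L (TW (Fp L) a)) (lineW_ne_zero L (TW (Fp L) a) (isUnit_det_TW (Fp L) a)) (toHeckeCharacter L lam) (borelPlaceMeasure L) (cmFinLocalFamily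 L e₁ dV hdV hdV0 (lineW L (TW (Fp L) a)) (complexConj_lineW L (TW (Fp L) a)) (lineW_ne_zero L (TW (Fp L) a) (isUnit_det_TW (Fp L) a)) (toHeckeCharacter L lam) ((isOscillatorChar_toHeckeCharacter_iff lam).mpr hlam) (borelPlaceMeasure L))) (isSymm_TW (Fp L) a) (JW_eq (Fp L) L a)) (Fin.cons (congrW L e₁ dV hdV (lineW L (TW (Fp L) a')) (complexConj_lineW L (TW (Fp L) a')) (realDiagonal_lineW L (TW (Fp L) a')) (diagonal_lineW L (TW (Fp L) a') (JW_eq (Fp L) L a')) (undoubledSplittings L e₁ dV hdV hdV0 (lineW L (TW (Fp L) a')) (complexConj_lineW L (TW (Fp L) a')) (lineW_ne_zero L (TW (Fp L) a') (isUnit_det_TW (Fp L) a')) (toHeckeCharacter L lam') (borelPlaceMeasure L) (cmFinLocalFamily L e₁ dV hdV hdV0 (lineW L (TW (Fp L) a')) (complexConj_lineW L (TW (Fp L) a')) (lineW_ne_zero L (TW (Fp L) a') (isUnit_det_TW (Fp L) a')) (toHeckeCharacter L lam') ((isOscillatorChar_toHeckeCharacter_iff lam').mpr hlam') (borelPlaceMeasure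 L))) (isSymm_TW (Fp L) a') (JW_eq (Fp L) L a')) finZeroElim)) ![localMu L (toHeckeCharacter L lam), localMu L (toHeckeCharacter L lam')]
        (by -- `|μ_v| = 1` for both members (★ `norm_localMu`); the assembler's proof argument here is `norm_localMu_pair L lam lam'`
          refine Fin.cases (fun v x => ?_) (fun k => Fin.cases (fun v x => ?_) (fun l => l.elim0) k)
          · exact norm_localMu L (toHeckeCharacter L lam) v (isUnitary_toHeckeCharacter L lam) x
          · exact norm_localMu L (toHeckeCharacter L lam') v (isUnitary_toHeckeCharacter L lam') x)
        (by -- continuity of `μ_v` for both members (★ `continuous_localMu`); the assembler's argument is `continuous_localMu_pair L lam lam'`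
          refine Fin.cases (fun v => ?_) (fun k => Fin.cases (fun v => ?_) (fun l => l.elim0) k)
          · exact continuous_localMu L (toHeckeCharacter L lam) v
          · exact continuous_localMu L (toHeckeCharacter L lam') v)
        (by -- `ker (μ_v|_{L⁺_vˣ}) = Nm` for both members (★ `localMu_toLocalRing_eq_one_iff`); the assembler's argument is `localMu_pair_toLocalRing_eq_one_iff L lam hlam lam' hlam'`
          refine Fin.cases (fun v t => ?_) (fun k => Fin.cases (fun v t => ?_) (fun l => l.elim0) k)
          · exact localMu_toLocalRing_eq_one_iff L (toHeckeCharacter L lam) v ((isOscillatorChar_toHeckeCharacter_iff lam).mpr hlam) t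
          · exact localMu_toLocalRing_eq_one_iff L (toHeckeCharacter L lam') v ((isOscillatorChar_toHeckeCharacter_iff lam').mpr hlam') t)
        v)

/-- Bookkeeping (proved): the full letter (4) implies the «if» letter (member-wise `LemD1_4AsPrintedI.toIf`).
[cite: Liu2021, App. D Lem. D.1 (4) (p. 126, TeX l. 5235)] -/
theorem LemD1_4AsPrintedNonsplitCM₂.toIf (h : LemD1_4AsPrintedNonsplitCM₂) : LemD1_4IfAsPrintedNonsplitCM₂ :=
  fun L _ _ _ dV hdV hdV0 _ e₁ lam hlam a χ a' lam' hlam' hcc hH v hv => (h L dV hdV hdV0 e₁ lam hlam a χ a' lam' hlam' hcc hH v hv).toIf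

end Literature.NumberTheory.Automorphic.Liu2021.LemD1RankTwoCMLetters
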